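import Mathlib.MeasureTheory.Integral.Bochner.Set
import Mathlib.MeasureTheory.Function.L1Space.Integrable
import Mathlib.Analysis.Complex.Basic
import HarnessLib

/-!
# F0 · P3c · line LH6 «StCharTS» — brick «SHELL-L1» of organ (S-a): AN `L¹` FUNCTION DECOMPOSED OVER A COUNTABLE MEASURABLE PARTITION GIVES A SUMMABLE
# SEQUENCE OF (twisted) SHELL INTEGRALS, `Σ_n ‖∫_{A_n} ψ·g‖ ≤ ‖g‖₁`

Cell `pub/hodgecm-mathlib`, crux H413 = `stmt-HodgeConjecture-24833` (lane `--supports … --as helper`), route HCCMUnconditional; seat LH6-p05 (g0); organ (S-a)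
`stub_StSupportFiniteSqInt` of `Cruxes/H413/Lines/F0_P3c_StCharTSPaydown.lean` ED. 1 :158, road card `F0/P3b/LH6-p05/g0/ROAD-Sa.v1.md` row (c) (print's `F_f` road);
desk F0P3b-plan (g23) deal 02:56:34Z (2).  THEOREMS ONLY, sorry-free, Mathlib-only.
HONEST LABEL: HC_CM is proved only modulo the 7 printed citations (2 remaining: hLiu418 = `stmt-HodgeConjecture-24832`, h413 = `stmt-HodgeConjecture-24833`) until
rung 0 closes; count-neutral measure theory.

THE MATHEMATICS.  [Rogawski1990, §12.7 proof of Lemma 12.7.2, p. 194]: after restricting the character identity to the split torus `M ≅ E^*` one has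
`Σ_{π∈X‴} b(π) Tr π(f) = ∫_{E^*} F_f(α) g(α) d^*α` «for some function `g(α)` which is integrable on `E^*`», and for `F_f` built from a `χ₀`-isotypic `φ` supported on the
shells `ωⁿ𝒪_E^*`, «`∫_{E^*} F_f(α) g(α) d^*α = Σ_n φ(ωⁿ) g_n` for some sequence `{g_n}` such that `Σ |g_n| < ∞`» — `g_n` being the integral of `g` against the unitary
twist `χ₀⁻¹` over the `n`-th shell.  Here, generically: for `g ∈ L¹(μ)`, a countable family of pairwise disjoint measurable sets `A_n` and a measurable weight `ψ` with
`‖ψ‖ ≤ 1`, the shell integrals `g_n := ∫_{A_n} ψ·g dμ` satisfy `Σ_n ‖g_n‖ ≤ ∫ ‖g‖ dμ < ∞`; with ★ «NODECAY» (`eq_zero_of_sum_mul_zpow_eq_summable`) this is the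
«`Σ|g_n| < ∞`» input of print's contradiction.

* `norm_setIntegral_mul_le` — `‖∫_{A} ψ·g‖ ≤ ∫_{A} ‖g‖` for `‖ψ‖ ≤ 1`.
* `summable_norm_setIntegral_mul` ∕ `tsum_norm_setIntegral_mul_le` — `Σ_n ‖∫_{A_n} ψ·g‖` converges and is `≤ ∫ ‖g‖`.
* `summable_setIntegral_mul` — hence `n ↦ ∫_{A_n} ψ·g` is summable (print's `{g_n}`).

## References
* [Rogawski1990] J. D. Rogawski, *Automorphic Representations of Unitary Groups in Three Variables*, Ann. of Math. Stud. 123 (1990), §12.7 proof of Lemma 12.7.2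
  p. 194.
-/

set_option autoImplicit false
-- the mandated namespace has the single-problem summit's repeated segment (`HodgeConjecture.HodgeConjecture`)
set_option linter.dupNamespace false

open MeasureTheory Filter Topology
open scoped BigOperators

namespace Summit.HodgeConjecture.HodgeConjecture.Cruxes.H413.F0P3cStCharTSShellL1

variable {X : Type*} [MeasurableSpace X] (μ : Measure X)

/-- **One shell**: for `g ∈ L¹(μ)` and a measurable weight `ψ` with `‖ψ‖ ≤ 1`, `‖∫_A ψ·g dμ‖ ≤ ∫_A ‖g‖ dμ`. [cite: Rogawski1990, §12.7 proof of Lemma 12.7.2 p. 194] -/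
theorem norm_setIntegral_mul_le (g ψ : X → ℂ) (hg : Integrable g μ) (hψ : ∀ x, ‖ψ x‖ ≤ 1) (A : Set X) :
    ‖∫ x in A, ψ x * g x ∂μ‖ ≤ ∫ x in A, ‖g x‖ ∂μ := by
  calc ‖∫ x in A, ψ x * g x ∂μ‖ ≤ ∫ x in A, ‖ψ x * g x‖ ∂μ := norm_integral_le_integral_norm _
    _ ≤ ∫ x in A, ‖g x‖ ∂μ := by
        refine integral_mono_of_nonneg (Eventually.of_forall fun x => norm_nonneg _) hg.norm.integrableOn (Eventually.of_forall fun x => ?_)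
        -- `‖ψ x * g x‖ ≤ ‖g x‖`
        show ‖ψ x * g x‖ ≤ ‖g x‖
        rw [norm_mul]
        calc ‖ψ x‖ * ‖g x‖ ≤ 1 * ‖g x‖ := mul_le_mul_of_nonneg_right (hψ x) (norm_nonneg _)
          _ = ‖g x‖ := one_mul _

/-- **All shells, norms**: for `g ∈ L¹(μ)`, pairwise disjoint measurable `A_n` (countable index) and `‖ψ‖ ≤ 1` measurable, `Σ_n ‖∫_{A_n} ψ·g‖` converges.
[cite: Rogawski1990, §12.7 proof of Lemma 12.7.2 p. 194] -/
theorem summable_norm_setIntegral_mul {ι : Type*} [Countable ι] (A : ι → Set X) (hA : ∀ n, MeasurableSet (A n))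
    (hdisj : Pairwise (Function.onFun Disjoint A)) (g ψ : X → ℂ) (hg : Integrable g μ) (hψ : ∀ x, ‖ψ x‖ ≤ 1) :
    Summable fun n => ‖∫ x in A n, ψ x * g x ∂μ‖ := by
  have hsum : HasSum (fun n => ∫ x in A n, ‖g x‖ ∂μ) (∫ x in ⋃ n, A n, ‖g x‖ ∂μ) :=
    hasSum_integral_iUnion hA hdisj hg.norm.integrableOn
  refine Summable.of_nonneg_of_le (fun n => norm_nonneg _) (fun n => norm_setIntegral_mul_le μ g ψ hg hψ (A n)) hsum.summable

/-- **All shells, the bound** `Σ_n ‖∫_{A_n} ψ·g dμ‖ ≤ ∫ ‖g‖ dμ` (print: «`Σ |g_n| < ∞`»). [cite: Rogawski1990, §12.7 proof of Lemma 12.7.2 p. 194] -/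
theorem tsum_norm_setIntegral_mul_le {ι : Type*} [Countable ι] (A : ι → Set X) (hA : ∀ n, MeasurableSet (A n))
    (hdisj : Pairwise (Function.onFun Disjoint A)) (g ψ : X → ℂ) (hg : Integrable g μ) (hψ : ∀ x, ‖ψ x‖ ≤ 1) :
    ∑' n, ‖∫ x in A n, ψ x * g x ∂μ‖ ≤ ∫ x, ‖g x‖ ∂μ := by
  have hsum : HasSum (fun n => ∫ x in A n, ‖g x‖ ∂μ) (∫ x in ⋃ n, A n, ‖g x‖ ∂μ) :=
    hasSum_integral_iUnion hA hdisj hg.norm.integrableOn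
  calc ∑' n, ‖∫ x in A n, ψ x * g x ∂μ‖ ≤ ∑' n, ∫ x in A n, ‖g x‖ ∂μ :=
        (summable_norm_setIntegral_mul μ A hA hdisj g ψ hg hψ).tsum_le_tsum (fun n => norm_setIntegral_mul_le μ g ψ hg hψ (A n)) hsum.summable
    _ = ∫ x in ⋃ n, A n, ‖g x‖ ∂μ := hsum.tsum_eq
    _ ≤ ∫ x, ‖g x‖ ∂μ := setIntegral_le_integral hg.norm (Eventually.of_forall fun x => norm_nonneg _)

/-- **Print's `{g_n}`**: the shell integrals `n ↦ ∫_{A_n} ψ·g dμ` form a summable sequence in `ℂ`. [cite: Rogawski1990, §12.7 proof of Lemma 12.7.2 p. 194] -/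
theorem summable_setIntegral_mul {ι : Type*} [Countable ι] (A : ι → Set X) (hA : ∀ n, MeasurableSet (A n))
    (hdisj : Pairwise (Function.onFun Disjoint A)) (g ψ : X → ℂ) (hg : Integrable g μ) (hψ : ∀ x, ‖ψ x‖ ≤ 1) :
    Summable fun n => ∫ x in A n, ψ x * g x ∂μ :=
  (summable_norm_setIntegral_mul μ A hA hdisj g ψ hg hψ).of_norm

/-- **The untwisted sum re-assembles `g`**: `Σ_n ∫_{A_n} ψ·g dμ = ∫_{⋃ A_n} ψ·g dμ` (and `= ∫ ψ·g dμ` when the `A_n` cover `X` up to a null set — not asserted).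
[cite: Rogawski1990, §12.7 proof of Lemma 12.7.2 p. 194] -/
theorem hasSum_setIntegral_mul {ι : Type*} [Countable ι] (A : ι → Set X) (hA : ∀ n, MeasurableSet (A n))
    (hdisj : Pairwise (Function.onFun Disjoint A)) (g ψ : X → ℂ) (hg : Integrable g μ) (hψm : AEStronglyMeasurable ψ μ) (hψ : ∀ x, ‖ψ x‖ ≤ 1) :
    HasSum (fun n => ∫ x in A n, ψ x * g x ∂μ) (∫ x in ⋃ n, A n, ψ x * g x ∂μ) :=
  hasSum_integral_iUnion hA hdisj (hg.bdd_mul hψm (Eventually.of_forall hψ)).integrableOn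

end Summit.HodgeConjecture.HodgeConjecture.Cruxes.H413.F0P3cStCharTSShellL1
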